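import Mathlib
import Summits.MatrixMultiplication.MatrixMultiplication.Theorems.LieRankDesigns.Negative.Basics
import Summits.MatrixMultiplication.MatrixMultiplication.Theorems.SubgroupIdentityDesigns.Negative.TorusCube

/-!
# The additive-box filter for level-`k` identity tests (negative lemma, crux `LieRankDesigns`, 7614)

A structural, character-free necessary condition for every "one function" design of the crux chain
(`LieRankDesigns` 7614, `SubgroupIdentityDesigns` 14079, `LevelOneGL2Designs` 14080): if a level-`k` function
`f = Σ_{rk M ≤ k} c_M ψ(tr(M·))` is `1` at the identity and `0` at the other points of an ADDITIVE BOX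
`{1 + Σ_i t_i e_i : t ∈ 𝔽_p^ι}` of invertible matrices (e.g. any `𝔽_p`-linear family of nilpotent matrices closed
enough to stay inside the tested set), then EVERY linear functional on the box must be induced by a matrix of rank
`≤ k`: precisely, for every matrix `Λ` some `M` with `tr((M − Λ)e_i) = 0` for all `i` has `rk M ≤ k`
(`no_idTest_of_additive_box`, contrapositive form).  Proof: the signed box sum `Σ_t ψ(−tr(Λ N_t)) f(1 + N_t)`
(`N_t = Σ t_i e_i`) counts the `t` with `N_t = 0` on the test side (a positive integer) and equals
`p^{|ι|} Σ_{M : tr((M−Λ)e_i) = 0 ∀ i} c_M ψ(tr M) = 0` on the Fourier side.  The transversal-radical obstruction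
(`Negative/TransversalRadicals.lean`, which kills line `subgroup-hosts-one-function`) is the instance "box = radical
block of `W'` plus the root line `l₀ ⊗ (V/g₂W')^*`, `Λ` = the matrix built there"; at `p = 2` the filter is the exact
criterion for boxes that are subgroups.  Sorry-free; standard axioms.
-/

set_option linter.dupNamespace false

noncomputable section

open scoped BigOperators
open Matrix

namespace Summit.MatrixMultiplication.MatrixMultiplication.Theorems.LieRankDesigns.Negative

open Summit.MatrixMultiplication.MatrixMultiplication.Theorems.SubgroupIdentityDesigns.Negative
  (stdAddChar_map_sum sum_psi_mul)

variable {p n : ℕ} [Fact p.Prime]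

/-- Box orthogonality over any finite index type: `Σ_{t ∈ 𝔽_p^ι} ψ(Σ_i a_i t_i) = p^{|ι|} [a = 0]`. [folklore] -/
theorem sum_psi_pi {ι : Type} [Fintype ι] [DecidableEq ι] (a : ι → ZMod p) :
    ∑ t : ι → ZMod p, ZMod.stdAddChar (∑ i : ι, a i * t i) =
      if a = 0 then ((p : ℂ) ^ Fintype.card ι) else 0 := by
  have hexp : ∀ t : ι → ZMod p, ZMod.stdAddChar (∑ i : ι, a i * t i) =
      ∏ i : ι, ZMod.stdAddChar (a i * t i) := fun t => stdAddChar_map_sum _ _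
  simp_rw [hexp]
  rw [← Fintype.prod_sum (fun i (x : ZMod p) => ZMod.stdAddChar (a i * x))]
  simp_rw [sum_psi_mul]
  split_ifs with ha
  · subst ha
    simp
  · obtain ⟨i, hi⟩ := Function.ne_iff.mp ha
    apply Finset.prod_eq_zero (Finset.mem_univ i)
    rw [if_neg (by simpa using hi)]

/-- **The additive-box filter.**  Let `e : ι → M_n(𝔽_p)` span a box of points `u(t) = 1 + Σ_i t_i e_i ∈ GL_n(𝔽_p)`,
and let `f = fourierFn c` be a level-`k` function (`RankSupp k c`) with `f(u t) = [Σ_i t_i e_i = 0]` (it is `1` at the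
identity and `0` at the other box points).  Then for every matrix `Λ` there is a matrix `M` of rank `≤ k` inducing the
same functional on the box (`tr((M − Λ) e_i) = 0` for all `i`).  Stated as the contradiction it yields when some `Λ`
admits no such `M`. [this file; folklore Fourier argument] -/
theorem no_idTest_of_additive_box {ι : Type} [Fintype ι] [DecidableEq ι] (k : ℕ) (e : ι → Mat p n)
    (u : (ι → ZMod p) → GLm p n) (hu : ∀ t, (u t : Mat p n) = 1 + ∑ i : ι, t i • e i)
    (Λ : Mat p n) (hΛ : ∀ M : Mat p n, (∀ i : ι, Matrix.trace ((M - Λ) * e i) = 0) → k < M.rank)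
    (c : Mat p n → ℂ) (hc : RankSupp k c)
    (htest : ∀ t, fourierFn c (u t) = if (∑ i : ι, t i • e i) = 0 then 1 else 0) : False := by
  classical
  set total : ℂ := ∑ t : ι → ZMod p,
    ZMod.stdAddChar (-Matrix.trace (Λ * ∑ i : ι, t i • e i)) * fourierFn c (u t) with htotal
  -- test side: `total` counts the `t` with `Σ t_i e_i = 0`, a positive integer
  have hterm : ∀ t : ι → ZMod p, ZMod.stdAddChar (-Matrix.trace (Λ * ∑ i : ι, t i • e i)) * fourierFn c (u t) =
      if (∑ i : ι, t i • e i) = 0 then 1 else 0 := by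
    intro t
    rw [htest t]
    by_cases hz : (∑ i : ι, t i • e i) = 0
    · rw [if_pos hz, hz, mul_zero, Matrix.trace_zero, neg_zero, AddChar.map_zero_eq_one, one_mul]
    · rw [if_neg hz, mul_zero]
  have hW1 : total ≠ 0 := by
    have htot : total = ((Finset.univ.filter fun t : ι → ZMod p => (∑ i : ι, t i • e i) = 0).card : ℂ) := by
      rw [htotal, Finset.natCast_card_filter]
      exact Finset.sum_congr rfl fun t _ => hterm t
    have hpos : 1 ≤ (Finset.univ.filter fun t : ι → ZMod p => (∑ i : ι, t i • e i) = 0).card :=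
      Finset.card_pos.mpr ⟨0, Finset.mem_filter.mpr ⟨Finset.mem_univ _, by simp⟩⟩
    rw [htot, Nat.cast_ne_zero]
    omega
  -- Fourier side: `total = Σ_M c_M ψ(tr M) · p^{|ι|} [tr((M−Λ)e_i) = 0 ∀ i] = 0`
  have htr : ∀ (M : Mat p n) (t : ι → ZMod p),
      Matrix.trace ((M - Λ) * ∑ i : ι, t i • e i) = ∑ i : ι, Matrix.trace ((M - Λ) * e i) * t i := by
    intro M t
    rw [Finset.mul_sum, Matrix.trace_sum]
    refine Finset.sum_congr rfl fun i _ => ?_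
    rw [Matrix.mul_smul, Matrix.trace_smul, smul_eq_mul, mul_comm]
  have hW2 : total = ∑ M : Mat p n, c M * (ZMod.stdAddChar (Matrix.trace M) *
      ∑ t : ι → ZMod p, ZMod.stdAddChar (∑ i : ι, Matrix.trace ((M - Λ) * e i) * t i)) := by
    have hstep : ∀ t : ι → ZMod p,
        ZMod.stdAddChar (-Matrix.trace (Λ * ∑ i : ι, t i • e i)) * fourierFn c (u t) =
        ∑ M : Mat p n, c M * (ZMod.stdAddChar (Matrix.trace M) *
          ZMod.stdAddChar (∑ i : ι, Matrix.trace ((M - Λ) * e i) * t i)) := by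
      intro t
      unfold fourierFn
      rw [hu t, Finset.mul_sum]
      refine Finset.sum_congr rfl fun M _ => ?_
      rw [← htr M t, ← AddChar.map_add_eq_mul, mul_left_comm, ← AddChar.map_add_eq_mul]
      congr 2
      simp only [Matrix.mul_add, Matrix.mul_one, Matrix.sub_mul, Matrix.trace_add, Matrix.trace_sub]
      ring
    calc total = ∑ t : ι → ZMod p, ∑ M : Mat p n, c M * (ZMod.stdAddChar (Matrix.trace M) *
          ZMod.stdAddChar (∑ i : ι, Matrix.trace ((M - Λ) * e i) * t i)) := by
          rw [htotal]; exact Finset.sum_congr rfl fun t _ => hstep t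
      _ = ∑ M : Mat p n, ∑ t : ι → ZMod p, c M * (ZMod.stdAddChar (Matrix.trace M) *
          ZMod.stdAddChar (∑ i : ι, Matrix.trace ((M - Λ) * e i) * t i)) := Finset.sum_comm
      _ = _ := by
          refine Finset.sum_congr rfl fun M _ => ?_
          rw [Finset.mul_sum, Finset.mul_sum]
  have hMzero : ∀ M : Mat p n, c M * (ZMod.stdAddChar (Matrix.trace M) *
      ∑ t : ι → ZMod p, ZMod.stdAddChar (∑ i : ι, Matrix.trace ((M - Λ) * e i) * t i)) = 0 := by
    intro M
    rw [sum_psi_pi]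
    by_cases ha : (fun i : ι => Matrix.trace ((M - Λ) * e i)) = 0
    · rw [hc M (hΛ M (fun i => congrFun ha i)), zero_mul]
    · rw [if_neg ha, mul_zero, mul_zero]
  exact hW1 (by rw [hW2]; exact Finset.sum_eq_zero fun M _ => hMzero M)

/-- **Identity-test form of the filter.**  If a tested set `S ⊆ GL_n(𝔽_p)` through `1` contains an additive box
`u(𝔽_p^ι)`, `u(t) = 1 + Σ t_i e_i`, and some functional `tr(Λ ·)` on the box is induced by no matrix of rank `≤ k`,
then no level-`k` function is `1` at `1` and `0` on `S ∖ 1`. [this file] -/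
theorem no_idTest_of_additive_box_subset {ι : Type} [Fintype ι] [DecidableEq ι] (k : ℕ) (e : ι → Mat p n)
    (u : (ι → ZMod p) → GLm p n) (hu : ∀ t, (u t : Mat p n) = 1 + ∑ i : ι, t i • e i)
    (S : Set (GLm p n)) (hS : ∀ t, u t ∈ S)
    (Λ : Mat p n) (hΛ : ∀ M : Mat p n, (∀ i : ι, Matrix.trace ((M - Λ) * e i) = 0) → k < M.rank)
    (c : Mat p n → ℂ) (hc : RankSupp k c) (h1 : fourierFn c 1 = 1)
    (h0 : ∀ s ∈ S, s ≠ 1 → fourierFn c s = 0) : False := by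
  refine no_idTest_of_additive_box k e u hu Λ hΛ c hc fun t => ?_
  by_cases hz : (∑ i : ι, t i • e i) = 0
  · have hu1 : u t = 1 := Units.ext (by rw [hu t, hz, add_zero, Units.val_one])
    rw [if_pos hz, hu1, h1]
  · have hu1 : u t ≠ 1 := fun h => hz (by
      have hv := congrArg (fun v : GLm p n => (v : Mat p n)) h
      simp only [hu t, Units.val_one] at hv
      simpa using hv)
    rw [if_neg hz, h0 _ (hS t) hu1]

end Summit.MatrixMultiplication.MatrixMultiplication.Theorems.LieRankDesigns.Negative

end
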